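import Summits.CriticalPhenomena.PercolationContinuityZ3.Theorems.PercNearOneGluingNoHeavyLowerTailKNGoodGMgcCertificate
import Summits.CriticalPhenomena.PercolationContinuityZ3.Theorems.PercNearOneGluingNoHeavyLowerTailKNGoodGMgcSideFrame
import HarnessLib

/-!
# Boundary tools: continuity and positivity of Bernoulli expectations along a line into the interior of the box; domination
# (`NoHeavyLowerTail` cell, stmt-CriticalPhenomena-4575; prover `prim-hp-2`, gen 19 — tools for closing the `D_j = 0` boundary of THEOREM B's
# certificates, memo `run/shared/lean/prim/prim-hp-2/MEMO-gen17-lean-certificates.md` §4 (S4)/§4' (L6))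

Support file (`--supports stmt-CriticalPhenomena-4575`; imports the COMPUTATIONAL `…KNGoodGMgcCertificate`; one `native_decide`d domination table
and nine sign checks).  One small definition (`xline`), no named facts, no sorries.
`KNGoodGMgc.certificate_j1/j2/j3` (`…KNGoodGMgcCertificate`) conclude `0 ≤ D_j(x) · Σ_v Φ_v(j;r)(x) v` with `D₁ = Q₁₂Q₁₃`,
`D₂ = Q₁₂Q₂₃(Q_d+Q₂₃)`, `D₃ = Q₁₂Q₁₃Q₂₃(Q_d+Q₂₃)`; the sequel `…KNGoodGMgcBoundary` removes `D_j` on the CLOSED box.  Tools: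
* `xline x₀ η` — the segment `η ↦ (1−η)x₀ + η/2` from `x₀` into the interior; `xline_mem`, `xline_interior`;
  `continuous_bexp_xline` — `η ↦ bexp m f (xline x₀ η)` is continuous (a polynomial);
* `bexp_pos_of_interior` — a nonnegative integrand that is positive somewhere has positive expectation at interior weights;
  `worldQ_pos_of_interior` (`π ∈ {0,3,5,6}`);
* `nonneg_at_zero_of_pos` — the one-variable limit argument (`Φ, D, R₁, R₂` continuous, `D > 0` on `(0,1]`, `R₁ R₂ ≥ 0 ⇒ 0 ≤ D·Φ`,
  `R₁(0), R₂(0) > 0` ⇒ `Φ(0) ≥ 0`); `nonneg_of_forall_pos_add` (`∀ s > 0, 0 ≤ a + s b ⇒ 0 ≤ a`);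
* DOMINATION: `phiHat_trunc`, `domCheck_all` (for the listed `(j, v, worlds)`: `phiHat j r c v ≠ 0 ⇒ sideWorld c ∈ worlds`, `native_decide`),
  **`phiCoef_eq_zero_of_worlds`** (`Σ_{π ∈ worlds} Q_π(x) = 0 ⇒ Φ_v(j;r)(x) = 0` on the box);
* signs `sb_2_r : 0 ≤ Φ_β(2;r)`, `sgp_2_r : 0 ≤ Φ_γ(2;r)`, `sep_3_r : 0 ≤ Φ_ε(3;r)` (checks, as in `…KNGoodGMgcCertificate`).
-/

noncomputable section

namespace Summit.CriticalPhenomena.PercolationContinuityZ3.Theorems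

namespace KNGoodGMgc

open SBTens
open scoped Classical Topology

/-! ## The line into the interior -/

/-- The segment from `x₀` to the centre of the box: `xline x₀ η k = (1−η)·x₀ k + η/2`. [this work] -/
def xline (x₀ : ℕ → ℝ) (η : ℝ) : ℕ → ℝ := fun k => (1 - η) * x₀ k + η * (1 / 2)

/-- `xline x₀ 0 = x₀`. [this work] -/
@[simp] theorem xline_zero (x₀ : ℕ → ℝ) : xline x₀ 0 = x₀ := by funext k; simp [xline]

/-- The segment stays in the box. [this work] -/
theorem xline_mem (x₀ : ℕ → ℝ) (hx : ∀ i, 0 ≤ x₀ i ∧ x₀ i ≤ 1) (η : ℝ) (h0 : 0 ≤ η) (h1 : η ≤ 1) :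
    ∀ i, 0 ≤ xline x₀ η i ∧ xline x₀ η i ≤ 1 := fun i => by
  obtain ⟨ha, hb⟩ := hx i
  constructor <;> simp only [xline] <;> nlinarith

/-- For `η ∈ (0,1]` the segment is in the open box. [this work] -/
theorem xline_interior (x₀ : ℕ → ℝ) (hx : ∀ i, 0 ≤ x₀ i ∧ x₀ i ≤ 1) (η : ℝ) (h0 : 0 < η) (h1 : η ≤ 1) :
    ∀ i, 0 < xline x₀ η i ∧ xline x₀ η i < 1 := fun i => by
  obtain ⟨ha, hb⟩ := hx i
  constructor <;> simp only [xline] <;> nlinarith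

/-- `η ↦ bexp m f (xline x₀ η)` is continuous. [folklore] -/
theorem continuous_bexp_xline (x₀ : ℕ → ℝ) : ∀ (m : ℕ) (f : Cfg → ℤ), Continuous fun η : ℝ => bexp m f (xline x₀ η)
  | 0, f => by simp only [bexp_zero]; exact continuous_const
  | m + 1, f => by
    simp only [bexp_succ]
    have hx : Continuous fun η : ℝ => xline x₀ η m := by unfold xline; fun_prop
    exact ((continuous_const.sub hx).mul (continuous_bexp_xline x₀ m _)).add (hx.mul (continuous_bexp_xline x₀ m _))

/-! ## Positivity -/

/-- **A nonnegative integrand that is positive at some configuration (vanishing from bit `m` on) has positive expectation at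
weights in the box that are interior below `m`.** [folklore] -/
theorem bexp_pos_of_interior : ∀ (m : ℕ) (f : Cfg → ℤ) (x : ℕ → ℝ), (∀ i, 0 ≤ x i ∧ x i ≤ 1) → (∀ k, k < m → 0 < x k ∧ x k < 1) →
    (∀ c, 0 ≤ f c) → (∃ c₀ : Cfg, (∀ k, m ≤ k → c₀ k = false) ∧ 0 < f c₀) → 0 < bexp m f x
  | 0, f, x, _, _, _, ⟨c₀, hc₀, hpos⟩ => by
    have : c₀ = fun _ => false := funext fun k => hc₀ k (Nat.zero_le k)
    rw [bexp_zero]; rw [this] at hpos; exact_mod_cast hpos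
  | m + 1, f, x, hbox, hx, hf, ⟨c₀, hc₀, hpos⟩ => by
    rw [bexp_succ]
    have hxm := hx m (Nat.lt_succ_self m)
    have hx' : ∀ k, k < m → 0 < x k ∧ x k < 1 := fun k hk => hx k (Nat.lt_succ_of_lt hk)
    have hnn : ∀ b : Bool, 0 ≤ bexp m (fun c => f (Function.update c m b)) x :=
      fun b => bexp_nonneg_of_pointwise m _ (fun c => hf _) x hbox
    have hwit : ∀ b : Bool, c₀ m = b → 0 < bexp m (fun c => f (Function.update c m b)) x := by
      intro b hb
      refine bexp_pos_of_interior m _ x hbox hx' (fun c => hf _) ⟨Function.update c₀ m false, fun k hk => ?_, ?_⟩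
      · by_cases hkm : k = m
        · subst hkm; simp
        · rw [Function.update_of_ne hkm]; exact hc₀ k (by omega)
      · simp only [Function.update_idem]
        rw [← hb, Function.update_eq_self]; exact hpos
    cases hcm : c₀ m
    · have := hwit false hcm; have := hnn true; nlinarith
    · have := hwit true hcm; have := hnn false; nlinarith

/-- World laws `Q_d, Q₁₂, Q₁₃, Q₂₃` are positive at interior weights. [this work] -/
theorem worldQ_pos_of_interior (π : ℕ) (hπ : π = 0 ∨ π = 3 ∨ π = 5 ∨ π = 6) (x : ℕ → ℝ) (hbox : ∀ i, 0 ≤ x i ∧ x i ≤ 1)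
    (hx : ∀ k, k < 12 → 0 < x k ∧ x k < 1) : 0 < worldQ π x := by
  refine bexp_pos_of_interior 12 _ x hbox hx (fun c => by unfold qHat; split_ifs <;> norm_num) ?_
  rcases hπ with rfl | rfl | rfl | rfl
  · exact ⟨fun _ => false, fun _ _ => rfl, by decide⟩
  · exact ⟨mk12 true true false false false false false false false false false false,
      fun k hk => by unfold mk12; split <;> first | rfl | omega, by decide⟩
  · exact ⟨mk12 true false true false false false false false false false false false,
      fun k hk => by unfold mk12; split <;> first | rfl | omega, by decide⟩
  · exact ⟨mk12 false true true false false false false false false false false false,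
      fun k hk => by unfold mk12; split <;> first | rfl | omega, by decide⟩

/-! ## One-variable limit arguments -/

/-- If `g` is continuous and `0 ≤ g η` for all small `η > 0`, then `0 ≤ g 0`. [folklore] -/
theorem nonneg_at_zero_of_eventually (g : ℝ → ℝ) (hg : Continuous g) (η₀ : ℝ) (hη₀ : 0 < η₀)
    (h : ∀ η, 0 < η → η < η₀ → 0 ≤ g η) : 0 ≤ g 0 := by
  by_contra hneg
  push Not at hneg
  have hev : ∀ᶠ η in 𝓝 (0 : ℝ), g η < 0 := (hg.tendsto 0).eventually (gt_mem_nhds hneg)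
  obtain ⟨ε, hε, hball⟩ := Metric.eventually_nhds_iff.1 hev
  have hη : 0 < min ε η₀ / 2 := by positivity
  have h1 : g (min ε η₀ / 2) < 0 := hball (by
    rw [Real.dist_eq, sub_zero, abs_of_pos hη]
    linarith [min_le_left ε η₀])
  have h2 := h (min ε η₀ / 2) hη (by linarith [min_le_right ε η₀])
  linarith

/-- **The limit step.**  `Φ, D, R₁, R₂ : ℝ → ℝ` continuous; `D > 0` on `(0,1]`; on `[0,1]`, `R₁, R₂ ≥ 0 ⇒ 0 ≤ D·Φ`; `R₁(0), R₂(0) > 0`.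
Then `Φ(0) ≥ 0`. [folklore] -/
theorem nonneg_at_zero_of_pos (Φ D R₁ R₂ : ℝ → ℝ) (hΦ : Continuous Φ) (hR₁ : Continuous R₁) (hR₂ : Continuous R₂)
    (hD : ∀ η, 0 < η → η ≤ 1 → 0 < D η) (hcert : ∀ η, 0 ≤ η → η ≤ 1 → 0 ≤ R₁ η → 0 ≤ R₂ η → 0 ≤ D η * Φ η)
    (h1 : 0 < R₁ 0) (h2 : 0 < R₂ 0) : 0 ≤ Φ 0 := by
  have e1 : ∀ᶠ η in 𝓝 (0 : ℝ), 0 < R₁ η := (hR₁.tendsto 0).eventually (lt_mem_nhds h1)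
  have e2 : ∀ᶠ η in 𝓝 (0 : ℝ), 0 < R₂ η := (hR₂.tendsto 0).eventually (lt_mem_nhds h2)
  obtain ⟨ε, hε, hball⟩ := Metric.eventually_nhds_iff.1 (e1.and e2)
  refine nonneg_at_zero_of_eventually Φ hΦ (min ε 1) (by positivity) fun η hη hηlt => ?_
  have hηε : dist η 0 < ε := by rw [Real.dist_eq, sub_zero, abs_of_pos hη]; linarith [min_le_left ε 1]
  obtain ⟨r1, r2⟩ := hball hηε
  have hη1 : η ≤ 1 := by linarith [min_le_right ε 1]
  have hprod := hcert η hη.le hη1 r1.le r2.le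
  have hDη := hD η hη hη1
  by_contra hneg
  push Not at hneg
  nlinarith

/-- If `0 ≤ a + s·b` for all `s > 0` then `0 ≤ a`. [folklore] -/
theorem nonneg_of_forall_pos_add (a b : ℝ) (h : ∀ s : ℝ, 0 < s → 0 ≤ a + s * b) : 0 ≤ a :=
  nonneg_at_zero_of_eventually (fun s => a + s * b) (by fun_prop) 1 one_pos (fun s hs _ => h s hs) |> fun h0 => by simpa using h0

/-! ## Domination: a target coefficient vanishes where the worlds it lives on have no mass -/

/-- `phiHat` reads only the bits below `12` (in fact below `11`). [this work] -/
theorem phiHat_trunc (j r : ℕ) (c : Cfg) : phiHat j r c = phiHat j r (trunc c) := by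
  have h : ∀ k, k < 12 → c k = trunc c k := fun k hk => (trunc_apply c k hk).symm
  simp only [phiHat, hitO, hitX, hitY, hitZ, h 0 (by norm_num), h 1 (by norm_num), h 2 (by norm_num), h 3 (by norm_num),
    h 4 (by norm_num), h 5 (by norm_num), h 6 (by norm_num), h 7 (by norm_num), h 8 (by norm_num), h 9 (by norm_num),
    h 10 (by norm_num)]

/-- `phiHat` does not read bit `11`. [this work] -/
theorem phiHat_dep (j r : ℕ) (v : Fin 5) : DepOn (fun i => i ≠ 11) (fun c => phiHat j r c v) := by
  intro c c' h
  simp only [phiHat, hitO, hitX, hitY, hitZ, h 0 (by norm_num), h 1 (by norm_num), h 2 (by norm_num), h 3 (by norm_num),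
    h 4 (by norm_num), h 5 (by norm_num), h 6 (by norm_num), h 7 (by norm_num), h 8 (by norm_num), h 9 (by norm_num),
    h 10 (by norm_num)]

/-- `qHat` reads only the bits below `12`. [this work] -/
theorem qHat_trunc (ws : List ℕ) (c : Cfg) : qHat ws c = qHat ws (trunc c) := by
  unfold qHat; rw [sideWorld_trunc c]

/-- One domination instance: `phiHat j r c v ≠ 0 ⇒ sideWorld c ∈ ws ∧ phiHat j r c v = ±1`. [this work] -/
def domOK (j r : ℕ) (v : Fin 5) (ws : List ℕ) (c : Cfg) : Bool :=
  (phiHat j r c v == 0) || (decide (sideWorld c ∈ ws) && (phiHat j r c v == 1 || phiHat j r c v == -1))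

/-- The domination instances used at the boundary (for all `r`): `j=1`: `α,β ← d`, `γ ← [13]`, `δ ← d,[23]`, `ε ← [12]`;
`j=2`: `α ← d`, `δ ← [23]`, `ε ← [12]`; `j=3`: `α,β ← d`, `γ ← [13]`, `δ ← [23]`, `ε ← d,[12]`. [this work] -/
def domAll (r : ℕ) (c : Cfg) : Bool :=
  domOK 1 r 0 [0] c && domOK 1 r 1 [0] c && domOK 1 r 2 [5] c && domOK 1 r 3 [0, 6] c && domOK 1 r 4 [3] c &&
  domOK 2 r 0 [0] c && domOK 2 r 3 [6] c && domOK 2 r 4 [3] c &&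
  domOK 3 r 0 [0] c && domOK 3 r 1 [0] c && domOK 3 r 2 [5] c && domOK 3 r 3 [6] c && domOK 3 r 4 [0, 3] c

/-- **The domination table** (COMPUTATIONAL, `native_decide` over `2¹²` configurations). [this work] -/
theorem domAll_all : ∀ b0 b1 b2 b3 b4 b5 b6 b7 b8 b9 b10 b11 : Bool,
    ([1, 2, 3].all fun r => domAll r (mk12 b0 b1 b2 b3 b4 b5 b6 b7 b8 b9 b10 b11)) = true := by
  native_decide

/-- `domAll r c` at every configuration. [this work] -/
theorem domAll_of (r : ℕ) (hr : r = 1 ∨ r = 2 ∨ r = 3) (c : Cfg) : domAll r (trunc c) = true := by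
  have h := domAll_all (c 0) (c 1) (c 2) (c 3) (c 4) (c 5) (c 6) (c 7) (c 8) (c 9) (c 10) (c 11)
  have hrm : r ∈ [1, 2, 3] := by rcases hr with rfl | rfl | rfl <;> simp
  exact List.all_eq_true.1 h r hrm

/-- **Domination kills a coefficient.**  If `phiHat j r · v` is supported on configurations whose world lies in `ws`, and the worlds of
`ws` carry no mass at `x` (in the box), then `Φ_v(j;r)(x) = 0`. [this work] -/
theorem phiCoef_eq_zero_of_dom (j r : ℕ) (v : Fin 5) (ws : List ℕ) (hdom : ∀ c : Cfg, domOK j r v ws (trunc c) = true)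
    (x : ℕ → ℝ) (hx : ∀ i, 0 ≤ x i ∧ x i ≤ 1) (h0 : bexp 12 (qHat ws) x = 0) : phiCoef j r v x = 0 := by
  -- pointwise `qHat ws ± phiHat ≥ 0`
  have hpt : ∀ c : Cfg, 0 ≤ qHat ws c - phiHat j r c v ∧ 0 ≤ qHat ws c + phiHat j r c v := by
    intro c
    have hd := hdom c
    unfold domOK at hd
    rw [← phiHat_trunc] at hd
    have hq : qHat ws c = qHat ws (trunc c) := qHat_trunc ws c
    have hq0 : 0 ≤ qHat ws c := by unfold qHat; split_ifs <;> norm_num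
    simp only [Bool.or_eq_true, Bool.and_eq_true, beq_iff_eq, decide_eq_true_eq] at hd
    rcases hd with hd | ⟨hw, hd⟩
    · rw [hd]; simpa using hq0
    · have hq1 : qHat ws c = 1 := by rw [← sideWorld_trunc c] at hw; unfold qHat; rw [if_pos hw]
      rw [hq1]; rcases hd with hd | hd <;> rw [hd] <;> norm_num
  have h1 : 0 ≤ bexp 12 (fun c => qHat ws c - phiHat j r c v) x := bexp_nonneg_of_pointwise 12 _ (fun c => (hpt c).1) x hx
  have h2 : 0 ≤ bexp 12 (fun c => qHat ws c + phiHat j r c v) x := bexp_nonneg_of_pointwise 12 _ (fun c => (hpt c).2) x hx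
  rw [bexp_sub, h0] at h1
  rw [bexp_add, h0] at h2
  have e : phiCoef j r v x = bexp 12 (fun c => phiHat j r c v) x := (bexp_succ_of_dep 11 _ (phiHat_dep j r v) x).symm
  rw [e]; linarith

/-! ## Signs of the positive coefficients used at the boundary (checks, 2 048 leaves each) -/

/-- `0 ≤ Φ_β(2;1)` (check). [this work] -/
theorem sb_2_1 : allNonneg 11 (ofFn 11 fun c => phiHat 2 1 c 1) = true := by native_decide
/-- `0 ≤ Φ_β(2;2)` (check). [this work] -/
theorem sb_2_2 : allNonneg 11 (ofFn 11 fun c => phiHat 2 2 c 1) = true := by native_decide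
/-- `0 ≤ Φ_β(2;3)` (check). [this work] -/
theorem sb_2_3 : allNonneg 11 (ofFn 11 fun c => phiHat 2 3 c 1) = true := by native_decide
/-- `0 ≤ Φ_γ(2;1)` (check). [this work] -/
theorem sgp_2_1 : allNonneg 11 (ofFn 11 fun c => phiHat 2 1 c 2) = true := by native_decide
/-- `0 ≤ Φ_γ(2;2)` (check). [this work] -/
theorem sgp_2_2 : allNonneg 11 (ofFn 11 fun c => phiHat 2 2 c 2) = true := by native_decide
/-- `0 ≤ Φ_γ(2;3)` (check). [this work] -/
theorem sgp_2_3 : allNonneg 11 (ofFn 11 fun c => phiHat 2 3 c 2) = true := by native_decide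
/-- `0 ≤ Φ_ε(3;1)` (check). [this work] -/
theorem sep_3_1 : allNonneg 11 (ofFn 11 fun c => phiHat 3 1 c 4) = true := by native_decide
/-- `0 ≤ Φ_ε(3;2)` (check). [this work] -/
theorem sep_3_2 : allNonneg 11 (ofFn 11 fun c => phiHat 3 2 c 4) = true := by native_decide
/-- `0 ≤ Φ_ε(3;3)` (check). [this work] -/
theorem sep_3_3 : allNonneg 11 (ofFn 11 fun c => phiHat 3 3 c 4) = true := by native_decide

/-- `0 ≤ Φ_β(2;r)`. [this work] -/
theorem phiCoef_beta_two_nonneg (r : ℕ) (hr : r = 1 ∨ r = 2 ∨ r = 3) (x : ℕ → ℝ) (hx : ∀ i, 0 ≤ x i ∧ x i ≤ 1) :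
    0 ≤ phiCoef 2 r 1 x := by
  rcases hr with rfl | rfl | rfl
  · exact bexp_nonneg_of_check 11 _ sb_2_1 x hx
  · exact bexp_nonneg_of_check 11 _ sb_2_2 x hx
  · exact bexp_nonneg_of_check 11 _ sb_2_3 x hx

/-- `0 ≤ Φ_γ(2;r)`. [this work] -/
theorem phiCoef_gamma_two_nonneg (r : ℕ) (hr : r = 1 ∨ r = 2 ∨ r = 3) (x : ℕ → ℝ) (hx : ∀ i, 0 ≤ x i ∧ x i ≤ 1) :
    0 ≤ phiCoef 2 r 2 x := by
  rcases hr with rfl | rfl | rfl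
  · exact bexp_nonneg_of_check 11 _ sgp_2_1 x hx
  · exact bexp_nonneg_of_check 11 _ sgp_2_2 x hx
  · exact bexp_nonneg_of_check 11 _ sgp_2_3 x hx

/-- `0 ≤ Φ_ε(3;r)`. [this work] -/
theorem phiCoef_eps_three_nonneg (r : ℕ) (hr : r = 1 ∨ r = 2 ∨ r = 3) (x : ℕ → ℝ) (hx : ∀ i, 0 ≤ x i ∧ x i ≤ 1) :
    0 ≤ phiCoef 3 r 4 x := by
  rcases hr with rfl | rfl | rfl
  · exact bexp_nonneg_of_check 11 _ sep_3_1 x hx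
  · exact bexp_nonneg_of_check 11 _ sep_3_2 x hx
  · exact bexp_nonneg_of_check 11 _ sep_3_3 x hx

end KNGoodGMgc

end Summit.CriticalPhenomena.PercolationContinuityZ3.Theorems

end
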